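import Literature.Analysis.FluidPDE.AxisymmetricEuler
import Literature.Analysis.FluidPDE.LerayHopf
import Literature.Analysis.FluidPDE.NSWave0
import HarnessLib

/-!
# Lei–Zhang 2017 and Wei 2016: swirl criteria for the axisymmetric Navier–Stokes equations

Topic `Literature/Analysis/FluidPDE`; named facts (results in print, `def … : Prop`, D-0014)
requested for the route `Summit.NavierStokesRegularity.NavierStokesRegularity.Theses.SwirlThreshold`
(crux `SmallSwirlRegularity`, the ABSOLUTE-constant strengthening of (a) below; work item
`wi-09811`) and the axis-modulus idea cards.

Z. Lei, Q. S. Zhang, *Criticality of the axially symmetric Navier–Stokes equations*, Pacific J.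
Math. 289 (2017), 169–187 (arXiv:1505.02628), §1.  Setting: the Cauchy problem for the
Navier–Stokes equations on `ℝ³` with viscosity `ν = 1` and no force, axially symmetric solutions
`v = vʳ e_r + v^θ e_θ + vᶻ e_z` (components independent of the angle), `Γ = r v^θ`,
`Ω = ω^θ / r` (`ω^θ` the angular component of `curl v`), `V = v^θ / √r`; "local strong
solutions" with data `v₀ ∈ H^{1/2}`, `‖Γ₀‖_{L^∞} < ∞`.

> **Corollary 1.3.** Let `δ₀ ∈ (0, 1/2)` and `C₁ > 1`. Let `v` be the local strong solution of the
> axially symmetric Navier–Stokes equations with initial data `v₀ ∈ H^{1/2}` and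
> `‖Γ₀‖_{L^∞} < ∞`. If `sup_{0 ≤ t < T} |Γ(t, r, z)| ≤ C₁ |ln r|^{−2}`, `r ≤ δ₀`, then `v` is
> regular globally in time.

> **Theorem 1.4.** Let `r₀ > 0`. Suppose that `v₀ ∈ H^{1/2}` such that `Ω₀ ∈ L²`, `V₀² ∈ L²` and
> `Γ₀ ∈ L² ∩ L^∞`. Denote `(‖Ω₀‖_{L²} + ‖V₀²‖_{L²}) ‖Γ₀‖_{L²} = M₀` […]. There exists an absolute
> positive (small) constant `δ > 0` such that if either `‖Γ₀‖_{L^∞} ≤ δ M₀⁻¹`, or […], then the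
> axially symmetric Navier–Stokes equations are globally well-posed.

D. Wei, *Regularity criterion to the axially symmetric Navier–Stokes equations*, J. Math. Anal.
Appl. 435 (2016), 402–413 (arXiv:1508.03318), §1 (strong solutions `u ∈ C([0, T*); H²)`,
"global regularity means `T* = +∞`"):

> **Corollary 1.1.** Let `δ₀ ∈ (0, 1/2)`, `u` be the strong solution of the axially symmetric
> Navier–Stokes equations with initial value `u₀ ∈ H²` and `‖Γ₀‖_{L^∞} < ∞`. If
> `|Γ(r, z, t)| ≤ |ln r|^{−3/2}` for all `0 < r ≤ δ₀`, then `u` is regular globally in time.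

* `LeiZhang2017.bigOmega u₀ = ω^θ/r`, `LeiZhang2017.vSq u₀ = (u^θ)²/r = V²`,
  `LeiZhang2017.M0 u₀ = (‖Ω₀‖₂ + ‖V₀²‖₂) ‖Γ₀‖₂ ∈ [0, ∞]` — the data functionals of Thm. 1.4.
* `LeiZhang2017_smallSwirl_regularity` — **Thm. 1.4, first alternative** (the RELATIVE
  small-swirl criterion `‖Γ₀‖_∞ ≤ δ M₀⁻¹`, `δ` absolute).
* `LeiZhang2017_logModulus_regularity` — **Cor. 1.3** (axis modulus `C₁ |ln r|^{−2}`).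
* `Wei2016_logModulus_regularity` — **Wei 2016, Cor. 1.1** (axis modulus `|ln r|^{−3/2}`).

## Rendering (a special case of the printed statements)

The printed results concern local strong solutions with `H^{1/2}` (Lei–Zhang) resp. `H²` (Wei)
data.  They are rendered here in the classical vocabulary of the tree and of the route
`SwirlThreshold` (`SmallSwirlRegularity`): a classical solution `(u, p)` of Navier–Stokes
(`ν = 1`, `f = 0`) on `[0, T) × ℝ³` (`IsClassicalNSSolutionOn (Ico 0 T) 1 0 u p`) which is
Leray–Hopf from its datum (`IsLerayHopfOn T 1 0 (u 0) u`), the datum rapidly decaying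
(`HasRapidSpatialDecay (u 0)`, Fefferman's class; in particular `u 0 ∈ H^{1/2} ∩ H²` and
`Γ₀ ∈ L^∞`, cf. `HasRapidSpatialDecay.abs_swirl_le`), every slice `u t` axisymmetric about the
`x₃`-axis (`IsAxisymmetric`, `AxisymmetricEuler.lean`; the printed "solutions of the axially
symmetric Navier–Stokes equations").  Such a `u` coincides on `[0, T)` with the printed local
strong solution from `u 0` (weak–strong uniqueness), so the printed conclusions "regular globally
in time" / "globally well-posed" yield, for every `T > 0`, that `u` **extends smoothly past `T`**
(`HasSmoothExtensionPast 1 0 u T`, Beale–Kato–Majda vocabulary of `ClassicalSolution.lean`) — the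
form in which the route consumes them; the hypotheses of Cor. 1.3 / Cor. 1.1 are imposed on
`[0, T)` only, exactly as printed (`sup_{0 ≤ t < T}`; Wei: on the existence interval).  This is
weaker than print (smaller data class, continuation instead of global well-posedness) and never
stronger.  `Γ = swirl` (`= x₀u₁ − x₁u₀ = r u^θ`), `u^θ = swirlVelocity`, `r = cylRadius`,
`ω = curl` are the accepted ones; `Ω₀`, `V₀²` carry the junk value `0` on the axis (a null set,
invisible to the `L²` norms).  The smallness `‖Γ₀‖_{L^∞} ≤ δ M₀⁻¹` is written in `ℝ≥0∞` as
`eLpNorm Γ₀ ∞ ≤ ofReal δ / M0` (`δ/0 = ∞`, `δ/∞ = 0`), with the printed finiteness hypotheses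
`Ω₀, V₀², Γ₀ ∈ L²`, `Γ₀ ∈ L^∞` kept explicit; `|ln r|^{−2}` is `C₁ / (log r)²` and `|ln r|^{−3/2}`
is `|log r|^{−3/2}` as real powers (at `r = 0` Lean's `log 0 = 0` makes the bound read `|Γ| ≤ 0`,
which holds on the axis where `Γ = 0`).  Viscosity `ν = 1` as printed (general `ν` by the scaling
`u ↦ ν⁻¹ u(ν⁻¹ t, x)`, not formalised).  Not restated: Lei–Zhang Def. 1.1 / Thm. 1.2 (form
boundedness condition), the second alternative of Thm. 1.4 (`sup_t ‖Γ(t)‖_{L^∞(r ≤ r₀)} ≤ δ M₁⁻¹`),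
Wei Thm. 1.1 (a)/(b).

## Mathlib / tree search

Mathlib has no Navier–Stokes theory.  Tree: `IsAxisymmetric`, `swirl`, `swirlVelocity`,
`cylRadius`, `curl` (`AxisymmetricEuler.lean`, `VectorCalculus.lean`); `IsClassicalNSSolutionOn`,
`HasSmoothExtensionPast` (`ClassicalSolution.lean`); `IsLerayHopfOn` (`LerayHopf.lean`);
`HasRapidSpatialDecay` (`NSWave0.lean`); the no-swirl global theory
(`AxisymmetricNoSwirlGlobal.lean`) and `knss_no_axisymmetric_typeI` (`Axisymmetric.lean`).  No
in-tree statement of Lei–Zhang 2017 or Wei 2016 (`lean search 'LeiZhang|Wei2016'`: docstring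
mentions only).

## References

* Z. Lei, Q. S. Zhang, Pacific J. Math. 289 (2017), 169–187, arXiv:1505.02628, §1: Def. 1.1,
  Thm. 1.2, Cor. 1.3, Thm. 1.4. [`LeiZhang2017`]
* D. Wei, J. Math. Anal. Appl. 435 (2016), 402–413, arXiv:1508.03318, §1: Thm. 1.1, Remark 1.1,
  Cor. 1.1. [`Wei2016`]
* H. Chen, D. Fang, T. Zhang, DCDS 37 (2017) (the `(J, Ω)` system). [`ChenFangZhang2017`]
-/

noncomputable section

open MeasureTheory Set Function Filter Topology TopologicalSpace
open scoped NNReal ENNReal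

namespace Literature.Analysis.FluidPDE

/-- Local notation for physical space `ℝ³ = EuclideanSpace ℝ (Fin 3)`. -/
local notation "ℝ³" => EuclideanSpace ℝ (Fin 3)

namespace LeiZhang2017

/-- `Ω = ω^θ / r`, the angular vorticity over the distance to the axis (Lei–Zhang 2017, §1, after
Cor. 1.3; Majda–Bertozzi), for a velocity field `u₀ : ℝ³ → ℝ³`: `ω^θ = swirlVelocity (curl u₀)`,
`r = cylRadius`.  Junk value `0` on the axis (`x/0 = 0`). [cite: LeiZhang2017, §1 (definition of Ω)] -/
def bigOmega (u₀ : ℝ³ → ℝ³) (x : ℝ³) : ℝ :=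
  swirlVelocity (curl u₀) x / cylRadius x

/-- `V² = (u^θ)² / r` with `V = u^θ / √r` (Lei–Zhang 2017, §1, before Thm. 1.4).  Junk value `0`
on the axis. [cite: LeiZhang2017, §1 (definition of V)] -/
def vSq (u₀ : ℝ³ → ℝ³) (x : ℝ³) : ℝ :=
  swirlVelocity u₀ x ^ 2 / cylRadius x

/-- The data functional `M₀ = (‖Ω₀‖_{L²} + ‖V₀²‖_{L²}) ‖Γ₀‖_{L²} ∈ [0, ∞]` of Lei–Zhang 2017,
Thm. 1.4, with `Γ₀ = swirl u₀ = r u₀^θ`. [cite: LeiZhang2017, Thm. 1.4] -/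
def M0 (u₀ : ℝ³ → ℝ³) : ℝ≥0∞ :=
  (eLpNorm (bigOmega u₀) 2 volume + eLpNorm (vSq u₀) 2 volume) * eLpNorm (swirl u₀) 2 volume

/-- `M₀ = 0` for a swirl-free datum (`Γ₀ = 0`). [folklore] -/
theorem M0_eq_zero_of_swirl_eq_zero {u₀ : ℝ³ → ℝ³} (h : swirl u₀ = 0) : M0 u₀ = 0 := by
  simp [M0, h]

end LeiZhang2017

/-- `|Γ(x)| = |x₀ u₁ − x₁ u₀| ≤ 2 |x| |u(x)|`. [folklore] -/
theorem abs_swirl_le_norm_mul (u : ℝ³ → ℝ³) (x : ℝ³) : |swirl u x| ≤ 2 * ‖x‖ * ‖u x‖ := by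
  have h0 : |x 0| ≤ ‖x‖ := (Real.norm_eq_abs _).symm.le.trans (PiLp.norm_apply_le x 0)
  have h1 : |x 1| ≤ ‖x‖ := (Real.norm_eq_abs _).symm.le.trans (PiLp.norm_apply_le x 1)
  have g0 : |u x 0| ≤ ‖u x‖ := (Real.norm_eq_abs _).symm.le.trans (PiLp.norm_apply_le (u x) 0)
  have g1 : |u x 1| ≤ ‖u x‖ := (Real.norm_eq_abs _).symm.le.trans (PiLp.norm_apply_le (u x) 1)
  calc |swirl u x| = |x 0 * u x 1 - x 1 * u x 0| := rfl
    _ ≤ |x 0 * u x 1| + |x 1 * u x 0| := abs_sub _ _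
    _ = |x 0| * |u x 1| + |x 1| * |u x 0| := by rw [abs_mul, abs_mul]
    _ ≤ ‖x‖ * ‖u x‖ + ‖x‖ * ‖u x‖ := by gcongr
    _ = 2 * ‖x‖ * ‖u x‖ := by ring

/-- A rapidly decaying datum has bounded swirl `Γ₀ = r u₀^θ` (the hypothesis `‖Γ₀‖_{L^∞} < ∞` of
Lei–Zhang 2017, Cor. 1.3 / Thm. 1.4 and Wei 2016, Cor. 1.1): `|Γ₀(x)| ≤ 2|x||u₀(x)| ≤ 2C` with
the constant of `HasRapidSpatialDecay` for `n = 0`, `K = 1`. [folklore] -/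
theorem HasRapidSpatialDecay.abs_swirl_le {u₀ : ℝ³ → ℝ³} (h : HasRapidSpatialDecay u₀) :
    ∃ C : ℝ, ∀ x, |swirl u₀ x| ≤ C := by
  obtain ⟨C, hC⟩ := h 0 1
  refine ⟨2 * C, fun x => ?_⟩
  have hx := hC x
  rw [pow_one, norm_iteratedFDeriv_zero] at hx
  have hxu : ‖x‖ * ‖u₀ x‖ ≤ C := by
    have : ‖x‖ * ‖u₀ x‖ ≤ (1 + ‖x‖) * ‖u₀ x‖ := by
      gcongr
      linarith [norm_nonneg x]
    exact this.trans hx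
  calc |swirl u₀ x| ≤ 2 * ‖x‖ * ‖u₀ x‖ := abs_swirl_le_norm_mul u₀ x
    _ = 2 * (‖x‖ * ‖u₀ x‖) := by ring
    _ ≤ 2 * C := by gcongr

/-! ### The named facts -/

/-- **Lei–Zhang 2017, Theorem 1.4 (first alternative): relative small-swirl regularity.**  "There
exists an absolute positive (small) constant `δ > 0` such that if `‖Γ₀‖_{L^∞} ≤ δ M₀⁻¹` […] then
the axially symmetric Navier–Stokes equations are globally well-posed", for data `v₀ ∈ H^{1/2}`
with `Ω₀ ∈ L²`, `V₀² ∈ L²`, `Γ₀ ∈ L² ∩ L^∞`, `M₀ = (‖Ω₀‖_{L²} + ‖V₀²‖_{L²}) ‖Γ₀‖_{L²}`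
(`ν = 1`).  Rendered (module docstring) for classical Leray–Hopf solutions on `[0, T)` from a
rapidly decaying datum with axisymmetric slices: under the printed finiteness hypotheses on the
datum `u 0` and `‖Γ₀‖_{L^∞} ≤ δ / M₀` (in `ℝ≥0∞`), the solution extends smoothly past `T`.  The
constant `δ` is absolute; the smallness is RELATIVE to `M₀`. [cite: LeiZhang2017, Thm. 1.4] -/
def LeiZhang2017_smallSwirl_regularity : Prop :=
  ∃ δ : ℝ, 0 < δ ∧ ∀ (T : ℝ) (u : ℝ → ℝ³ → ℝ³) (p : ℝ → ℝ³ → ℝ), 0 < T →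
    IsClassicalNSSolutionOn (Ico 0 T) 1 0 u p → IsLerayHopfOn T 1 0 (u 0) u →
    HasRapidSpatialDecay (u 0) → (∀ t ∈ Ico 0 T, IsAxisymmetric (u t)) →
    eLpNorm (LeiZhang2017.bigOmega (u 0)) 2 volume < ∞ →
    eLpNorm (LeiZhang2017.vSq (u 0)) 2 volume < ∞ →
    eLpNorm (swirl (u 0)) 2 volume < ∞ → eLpNorm (swirl (u 0)) ∞ volume < ∞ →
    eLpNorm (swirl (u 0)) ∞ volume ≤ ENNReal.ofReal δ / LeiZhang2017.M0 (u 0) →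
    HasSmoothExtensionPast 1 0 u T

/-- **Lei–Zhang 2017, Corollary 1.3 (logarithmic axis modulus).**  "Let `δ₀ ∈ (0, 1/2)` and
`C₁ > 1`. Let `v` be the local strong solution of the axially symmetric Navier–Stokes equations
with initial data `v₀ ∈ H^{1/2}` and `‖Γ₀‖_{L^∞} < ∞`. If `sup_{0 ≤ t < T} |Γ(t, r, z)| ≤ C₁|ln r|^{−2}`,
`r ≤ δ₀`, then `v` is regular globally in time" (`ν = 1`; `C₁` and `δ₀` independent of the data).
Rendered (module docstring) for classical Leray–Hopf solutions on `[0, T)` from a rapidly decaying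
datum with axisymmetric slices: the bound `|Γ(t, x)| ≤ C₁ / (log r)²` for `t ∈ [0, T)` and
`r = cylRadius x ≤ δ₀` forces a smooth extension past `T`. [cite: LeiZhang2017, Cor. 1.3] -/
def LeiZhang2017_logModulus_regularity : Prop :=
  ∀ (δ₀ C₁ : ℝ), 0 < δ₀ → δ₀ < 1 / 2 → 1 < C₁ →
    ∀ (T : ℝ) (u : ℝ → ℝ³ → ℝ³) (p : ℝ → ℝ³ → ℝ), 0 < T →
    IsClassicalNSSolutionOn (Ico 0 T) 1 0 u p → IsLerayHopfOn T 1 0 (u 0) u →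
    HasRapidSpatialDecay (u 0) → (∀ t ∈ Ico 0 T, IsAxisymmetric (u t)) →
    eLpNorm (swirl (u 0)) ∞ volume < ∞ →
    (∀ t ∈ Ico 0 T, ∀ x : ℝ³, cylRadius x ≤ δ₀ →
      |swirl (u t) x| ≤ C₁ / Real.log (cylRadius x) ^ 2) →
    HasSmoothExtensionPast 1 0 u T

/-- **Wei 2016, Corollary 1.1 (axis modulus `|ln r|^{−3/2}`).**  "Let `δ₀ ∈ (0, 1/2)`, `u` be the
strong solution of the axially symmetric Navier–Stokes equations with initial value `u₀ ∈ H²` and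
`‖Γ₀‖_{L^∞} < ∞`. If `|Γ(r, z, t)| ≤ |ln r|^{−3/2}` for all `0 < r ≤ δ₀`, then `u` is regular
globally in time" (`ν = 1`; the bound, with constant exactly `1`, is imposed on the existence
interval, `u ∈ C([0, T*); H²)`).  Rendered (module docstring) for classical Leray–Hopf solutions on
`[0, T)` from a rapidly decaying datum with axisymmetric slices: the bound
`|Γ(t, x)| ≤ |log r|^{−3/2}` for `t ∈ [0, T)`, `0 < r = cylRadius x ≤ δ₀` forces a smooth extension
past `T`. [cite: Wei2016, Cor. 1.1] -/
def Wei2016_logModulus_regularity : Prop :=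
  ∀ δ₀ : ℝ, 0 < δ₀ → δ₀ < 1 / 2 →
    ∀ (T : ℝ) (u : ℝ → ℝ³ → ℝ³) (p : ℝ → ℝ³ → ℝ), 0 < T →
    IsClassicalNSSolutionOn (Ico 0 T) 1 0 u p → IsLerayHopfOn T 1 0 (u 0) u →
    HasRapidSpatialDecay (u 0) → (∀ t ∈ Ico 0 T, IsAxisymmetric (u t)) →
    eLpNorm (swirl (u 0)) ∞ volume < ∞ →
    (∀ t ∈ Ico 0 T, ∀ x : ℝ³, 0 < cylRadius x → cylRadius x ≤ δ₀ →
      |swirl (u t) x| ≤ |Real.log (cylRadius x)| ^ (-(3 / 2 : ℝ))) →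
    HasSmoothExtensionPast 1 0 u T

/-! ### API -/

/-- The `L^∞` finiteness hypothesis on `Γ₀` in the three facts is automatic for rapidly decaying
data (so consumers may discharge it with this lemma). [folklore] -/
theorem HasRapidSpatialDecay.eLpNorm_swirl_lt_top {u₀ : ℝ³ → ℝ³} (h : HasRapidSpatialDecay u₀) :
    eLpNorm (swirl u₀) ∞ volume < ∞ := by
  obtain ⟨C, hC⟩ := h.abs_swirl_le
  refine (eLpNorm_le_of_ae_bound (C := C) (Filter.Eventually.of_forall fun x => ?_)).trans_lt ?_
  · simpa [Real.norm_eq_abs] using hC x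
  · simp

/-- Wei's modulus is weaker than Lei–Zhang's at small `r`: for `0 < r ≤ δ₀ < 1/2` and `C₁ ≥ 1`,
`|log r|^{−2} ≤ C₁ / (log r)²`, and `|log r|^{−2} ≤ |log r|^{−3/2}` once `|log r| ≥ 1`
(i.e. `r ≤ e⁻¹`); recorded in the simplest form `(log r)⁻² ≤ |log r|^{−3/2}` for `|log r| ≥ 1`.
[folklore] -/
theorem inv_log_sq_le_rpow {r : ℝ} (hr : 1 ≤ |Real.log r|) :
    (Real.log r ^ 2)⁻¹ ≤ |Real.log r| ^ (-(3 / 2 : ℝ)) := by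
  have hpos : 0 < |Real.log r| := lt_of_lt_of_le one_pos hr
  rw [show Real.log r ^ 2 = |Real.log r| ^ (2 : ℝ) by
    rw [← sq_abs, Real.rpow_two], ← Real.rpow_neg hpos.le]
  exact Real.rpow_le_rpow_of_exponent_le hr (by norm_num)

/-- Under Lei–Zhang's Cor. 1.3 with `C₁ > 1`, Wei's hypothesis (constant `1`, exponent `3/2`) on
`{0 < r ≤ min δ₀ e⁻¹}` implies Lei–Zhang's bound there: `|Γ| ≤ |log r|^{−3/2}` is the WEAKER decay
requirement, so `Wei2016_logModulus_regularity` is the stronger criterion near the axis; this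
lemma records the pointwise comparison of the two moduli used in that remark
(Wei 2016, §1: "Clearly, our Corollary 1.1 improves the one in [Lei–Zhang]"). [cite: Wei2016, §1] -/
theorem leiZhang_modulus_le_wei_modulus {r C₁ : ℝ} (hC : 1 ≤ C₁) (hr : 1 ≤ |Real.log r|) :
    (Real.log r ^ 2)⁻¹ ≤ C₁ / Real.log r ^ 2 ∧ (Real.log r ^ 2)⁻¹ ≤ |Real.log r| ^ (-(3 / 2 : ℝ)) := by
  refine ⟨?_, inv_log_sq_le_rpow hr⟩
  rw [inv_eq_one_div]
  have hpos : 0 < Real.log r ^ 2 := by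
    have : 0 < |Real.log r| := lt_of_lt_of_le one_pos hr
    rw [← sq_abs]
    exact pow_pos this 2
  exact div_le_div_of_nonneg_right hC hpos.le

end Literature.Analysis.FluidPDE
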